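import Summits.KontsevichZagierPeriods.Zeta5Search.Certificates.RayH1KernelClassWin
import Summits.KontsevichZagierPeriods.Zeta5Search.Certificates.RayC1KernelClassTable
import HarnessLib

/-!
# ζ(5) search — certificates: the kernel multiplier of ANY checked window table of the ray RayH1, and its exponent (TYPER g17 machine, run by p3 g7)

HONEST FRAMING: systematic search; no irrationality claim unless certified.  Valuation bookkeeping of explicit rationals; every
exponent this file yields in the cell is `< 1` — a calibration, nothing about the arithmetic nature of `ζ(5)`.

OUR work (Summit side; typer seat g17's generator `HOME/pub-zeta5-typer-g17/gen/gen_kernelclass.py H1`, run VERBATIM for the ray H1 by prover seat p3 g7).  Sequel of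
`RayH1KernelClassWin` (the checker `entryOK` and its soundness `entry_cert`) — p3 g5's `record_exponent_of_table` for this ray on typer
g16's frame.  A checker `ok : WinEntry → Bool` is SOUND from `NT` (`SoundChecker ok NT`) when every passing entry is a window
`0 < A ≤ B ≤ 15` whose primes carry `p^k ∣ wedgeNumZ b b′ ∧ p^k ∣ qNumZ b b′` for all `n ≥ NT` — `entryOK cw NT` is sound under
`∀ c ∈ cw, c.Holds` (`soundChecker_entryOK`), and sound checkers combine (`soundChecker_or`, for tables mixing further sources later).
For ANY list `tab : List WinEntry` that passes a sound checker (`tab.all ok`) and the linear chain check `chainOK tab`: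
* `kMT tab n = kM0 n / (Φ_K · Φ_tab)` — the baseline `d⁹N♯N♯′/|ρ|` of `RayH1KernelBase` divided by the big-prime atlas of
  `RayH1KernelBigPrime` (rate `178.0`) and by the table's window product (`RayKernel.atlas_ints` over `Fin 4 ⊕ Fin tab.length`):
  `kMT_ints` (`n ≥ NT ≥ 544`), `eventually_kMT_le_exp` (rate `141.7159 − Σ_tab k(B − A)`);
* **`h1_exponent_of_table`** — every `γ ≥ 0` with `γ·(141.7159 − R + 0.01 + c_u) < c_l − ℓ` (`R` the table's rate literal; the ray's
  certified decay/growth `ℓ = -273999 / 10000`, `[c_l, c_u] = [729343 / 10000, 364673 / 5000]` of `h1_exponent_rat`) is an effective exponent of the ray.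
So a consumption ROUND is: a table (data), three `decide`s, the `Holds` list of the landed class-law windows, one application of this theorem;
a table in two parts (a static low part, the round's high part) is assembled by `all_entryOK_append` / `chainOK_append` / `rate_append` (the ray-independent list lemmas are those of `RayC1KernelClassTable`, imported).
-/

noncomputable section

open Finset Real Filter Topology

namespace Summit.KontsevichZagierPeriods.Zeta5Search.RayH1

open Summit.KontsevichZagierPeriods.Zeta5Search.DualSeries
open Summit.KontsevichZagierPeriods.Zeta5Search.DualSeriesDenominators
open Summit.KontsevichZagierPeriods.Zeta5Search.WedgeDictionary
open Summit.KontsevichZagierPeriods.Zeta5Search.RayKernel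
open Literature.NumberTheory.Irrationality.Hata1992
open Literature.NumberTheory.Transcendental (zetaValue)
open Summit.KontsevichZagierPeriods.Zeta5Search.RayH1 (windowPrimes_disjoint_of_le)
open Summit.KontsevichZagierPeriods.Zeta5Search.RayC1 (all_entryOK_append all_mono rate_append)

/-! ### Sound checkers -/

/-- A SOUND entry checker from `NT` on: every passing entry `(A, B, k, ·)` is a window `0 < A ≤ B ≤ 15` and, for every `n ≥ NT`, every
prime `A·n < p ≤ B·n` carries `p^k ∣ wedgeNumZ b b′` and `p^k ∣ qNumZ b b′` (`b = bH1 n`). -/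
def SoundChecker (ok : WinEntry → Bool) (NT : ℕ) : Prop :=
  ∀ e : WinEntry, ok e = true → (0 < e.1 ∧ e.1 ≤ e.2.1 ∧ e.2.1 ≤ 15) ∧
    ∀ n : ℕ, NT ≤ n → ∀ p ∈ windowPrimes ((e.1 : ℚ) : ℝ) ((e.2.1 : ℚ) : ℝ) n,
      (p : ℤ) ^ e.2.2.1 ∣ wedgeNumZ (bH1 n) (bH1' n) ∧ (p : ℤ) ^ e.2.2.1 ∣ qNumZ (bH1 n) (bH1' n)

/-- **`entryOK cw NT` is sound from `NT ≥ 544`** under `∀ c ∈ cw, c.Holds` (`entryOK_basic`, `entry_cert`). -/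
theorem soundChecker_entryOK {cw : List CWin} (hcw : ∀ c ∈ cw, c.Holds) {NT : ℕ} (hNT : 544 ≤ NT) :
    SoundChecker (entryOK cw NT) NT :=
  fun _ h => ⟨entryOK_basic h, fun _ hn _ hp => entry_cert hcw hNT h hn hp⟩

/-- Sound checkers combine by `||` (a table may mix window sources with different checkers). -/
theorem soundChecker_or {ok₁ ok₂ : WinEntry → Bool} {NT : ℕ} (h₁ : SoundChecker ok₁ NT) (h₂ : SoundChecker ok₂ NT) :
    SoundChecker (fun e => ok₁ e || ok₂ e) NT := by
  intro e h
  rw [Bool.or_eq_true] at h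
  rcases h with h | h
  · exact h₁ e h
  · exact h₂ e h

/-- A sound checker stays sound from any later `NT′ ≥ NT`. -/
theorem soundChecker_mono {ok : WinEntry → Bool} {NT NT' : ℕ} (h : SoundChecker ok NT) (hle : NT ≤ NT') : SoundChecker ok NT' :=
  fun e he => ⟨(h e he).1, fun n hn p hp => (h e he).2 n (le_trans hle hn) p hp⟩


variable (tab : List WinEntry)

/-! ### A table as an atlas indexed by `Fin tab.length` -/

/-- Left endpoint of table window `i`. -/
def tA (i : Fin tab.length) : ℚ := (tab[(i : ℕ)]).1

/-- Right endpoint of table window `i`. -/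
def tB (i : Fin tab.length) : ℚ := (tab[(i : ℕ)]).2.1

/-- Weight of table window `i`. -/
def twt (i : Fin tab.length) : ℕ := (tab[(i : ℕ)]).2.2.1

variable {tab}

/-- A chain-checked table is sorted and separated: `B_i ≤ A_j` for `i < j`. -/
theorem tab_sorted (hchain : chainOK tab = true) (i j : Fin tab.length) (hij : i < j) : tB tab i ≤ tA tab j :=
  chainOK_sorted hchain i j hij j.isLt

/-- Every window of a checked table: `0 < A_i ≤ B_i ≤ 15`. -/
theorem tab_basic {ok : WinEntry → Bool} {NT : ℕ} (hs : SoundChecker ok NT) (hok : tab.all ok = true) (i : Fin tab.length) :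
    0 < tA tab i ∧ tA tab i ≤ tB tab i ∧ tB tab i ≤ 15 :=
  (hs _ (getElem_all hok i i.isLt)).1

variable (tab)

/-- The table's rate over the index type is its list sum `Σ k·(B − A)`. -/
theorem tab_rate : ∑ i : Fin tab.length, (twt tab i : ℚ) * (tB tab i - tA tab i) =
    (tab.map fun e => (e.2.2.1 : ℚ) * (e.2.1 - e.1)).sum := by
  rw [← sum_fin_getElem_eq_map_sum]
  rfl

/-! ### Tables in two parts (a static low part `θ < 1` and the per-round high part) -/

variable {tab}



/-- The link check between two tables: the last window of the first ends before the first window of the second begins. -/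
def chainLink (l₁ l₂ : List WinEntry) : Bool :=
  match l₁.getLast?, l₂.head? with
  | some e, some f => decide (e.2.1 ≤ f.1)
  | _, _ => true

/-- `chainOK` of a concatenation from its parts and the link. -/
theorem chainOK_append : ∀ {l₁ l₂ : List WinEntry}, chainOK l₁ = true → chainOK l₂ = true → chainLink l₁ l₂ = true →
    chainOK (l₁ ++ l₂) = true
  | [], l₂, _, h₂, _ => by simpa using h₂
  | [e], [], h₁, _, _ => by simpa using h₁
  | [e], f :: t, h₁, h₂, hl => by
    have he : e.1 ≤ e.2.1 := by simpa [chainOK] using h₁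
    have hl' : e.2.1 ≤ f.1 := by simpa [chainLink] using hl
    show chainOK (e :: f :: t) = true
    exact chainOK_cons_cons.2 ⟨he, hl', h₂⟩
  | e₁ :: e₂ :: t, l₂, h₁, h₂, hl => by
    obtain ⟨ha, hb, hc⟩ := chainOK_cons_cons.1 h₁
    have hl2 : chainLink (e₂ :: t) l₂ = true := by
      cases l₂ with
      | nil => simp [chainLink]
      | cons f u =>
        have : (e₁ :: e₂ :: t).getLast? = (e₂ :: t).getLast? := by simp [List.getLast?_cons_cons]
        simpa [chainLink, this] using hl
    have ih := chainOK_append hc h₂ hl2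
    show chainOK (e₁ :: (e₂ :: (t ++ l₂))) = true
    exact chainOK_cons_cons.2 ⟨ha, hb, ih⟩


variable (tab)

/-! ### The combined atlas `Φ_K · Φ_tab` over `Fin 4 ⊕ Fin tab.length` -/

/-- Left endpoints of the combined atlas (big-prime windows, then table windows), real. -/
def cAT : Fin 4 ⊕ Fin tab.length → ℝ := Sum.elim AwK (fun i => ((tA tab i : ℚ) : ℝ))

/-- Right endpoints of the combined atlas. -/
def cBT : Fin 4 ⊕ Fin tab.length → ℝ := Sum.elim BwK (fun i => ((tB tab i : ℚ) : ℝ))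

/-- Weights of the combined atlas. -/
def cwT : Fin 4 ⊕ Fin tab.length → ℕ := Sum.elim wwK (twt tab)

/-- The combined window factor `Φ_n = Φ_K · Φ_tab`. -/
def corrT (n : ℕ) : ℕ := multiWindowProd Finset.univ (cAT tab) (cBT tab) (cwT tab) n

/-- **The multiplier of the table** `kMT tab n = kM0 n / (Φ_K Φ_tab)`. -/
def kMT (n : ℕ) : ℚ := kM0 n / (corrT tab n : ℚ)

variable {tab}

/-- The windows are genuine intervals: `0 ≤ A ≤ B`. -/
theorem cAT_le_cBT {ok : WinEntry → Bool} {NT : ℕ} (hs : SoundChecker ok NT) (hok : tab.all ok = true) :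
    ∀ i ∈ (Finset.univ : Finset (Fin 4 ⊕ Fin tab.length)), 0 ≤ cAT tab i ∧ cAT tab i ≤ cBT tab i := by
  rintro (i | i) -
  · exact AwK_le_BwK i (Finset.mem_univ _)
  · obtain ⟨hA0, hAB, -⟩ := tab_basic hs hok i
    simp only [cAT, cBT, Sum.elim_inr]
    exact ⟨by exact_mod_cast hA0.le, by exact_mod_cast hAB⟩

/-- The rate of the combined atlas: `178.0 + Σ_tab k(B − A)`. -/
theorem combined_rateT {R : ℚ} (hrate : (tab.map fun e => (e.2.2.1 : ℚ) * (e.2.1 - e.1)).sum = R) :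
    ∑ i ∈ (Finset.univ : Finset (Fin 4 ⊕ Fin tab.length)), (cwT tab i : ℝ) * (cBT tab i - cAT tab i) = 178 + ((R : ℚ) : ℝ) := by
  rw [Fintype.sum_sum_type]
  simp only [cwT, cAT, cBT, Sum.elim_inl, Sum.elim_inr]
  rw [window_rateK, ← hrate, ← tab_rate]
  push_cast
  rfl

/-- The combined windows are pairwise disjoint (big-prime windows above `θ = 15`, table windows below, both sorted). -/
theorem combined_disjointT {ok : WinEntry → Bool} {NT : ℕ} (hs : SoundChecker ok NT) (hok : tab.all ok = true)
    (hchain : chainOK tab = true) (n : ℕ) :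
    ∀ i ∈ (Finset.univ : Finset (Fin 4 ⊕ Fin tab.length)), ∀ j ∈ (Finset.univ : Finset (Fin 4 ⊕ Fin tab.length)),
    i ≠ j → Disjoint (windowPrimes (cAT tab i) (cBT tab i) n) (windowPrimes (cAT tab j) (cBT tab j) n) := by
  rintro (i | i) - (j | j) - hij
  · exact windowsK_disjoint n i (Finset.mem_univ _) j (Finset.mem_univ _) (fun h => hij (by rw [h]))
  · obtain ⟨hA0j, -, hBlo⟩ := tab_basic hs hok j
    have hAi : (15 : ℝ) ≤ AwK i := by fin_cases i <;> simp [AwK] <;> norm_num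
    have hBj : ((tB tab j : ℚ) : ℝ) ≤ 15 := by exact_mod_cast hBlo
    have h0j : (0 : ℝ) ≤ ((tA tab j : ℚ) : ℝ) := by exact_mod_cast hA0j.le
    show Disjoint (windowPrimes (AwK i) (BwK i) n) (windowPrimes ((tA tab j : ℚ) : ℝ) ((tB tab j : ℚ) : ℝ) n)
    exact (windowPrimes_disjoint_of_le h0j (AwK_le_BwK i (Finset.mem_univ _)).1 (by linarith) n).symm
  · obtain ⟨hA0i, -, hBlo⟩ := tab_basic hs hok i
    have hAj : (15 : ℝ) ≤ AwK j := by fin_cases j <;> simp [AwK] <;> norm_num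
    have hBi : ((tB tab i : ℚ) : ℝ) ≤ 15 := by exact_mod_cast hBlo
    have h0i : (0 : ℝ) ≤ ((tA tab i : ℚ) : ℝ) := by exact_mod_cast hA0i.le
    show Disjoint (windowPrimes ((tA tab i : ℚ) : ℝ) ((tB tab i : ℚ) : ℝ) n) (windowPrimes (AwK j) (BwK j) n)
    exact windowPrimes_disjoint_of_le h0i (AwK_le_BwK j (Finset.mem_univ _)).1 (by linarith) n
  · have hij' : i ≠ j := fun h => hij (by rw [h])
    have h0i : (0 : ℝ) ≤ ((tA tab i : ℚ) : ℝ) := by exact_mod_cast (tab_basic hs hok i).1.le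
    have h0j : (0 : ℝ) ≤ ((tA tab j : ℚ) : ℝ) := by exact_mod_cast (tab_basic hs hok j).1.le
    show Disjoint (windowPrimes ((tA tab i : ℚ) : ℝ) ((tB tab i : ℚ) : ℝ) n) (windowPrimes ((tA tab j : ℚ) : ℝ) ((tB tab j : ℚ) : ℝ) n)
    rcases lt_or_gt_of_ne hij' with hlt | hlt
    · have hs : ((tB tab i : ℚ) : ℝ) ≤ ((tA tab j : ℚ) : ℝ) := by exact_mod_cast tab_sorted hchain i j hlt
      exact windowPrimes_disjoint_of_le h0i h0j hs n
    · have hs : ((tB tab j : ℚ) : ℝ) ≤ ((tA tab i : ℚ) : ℝ) := by exact_mod_cast tab_sorted hchain j i hlt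
      exact (windowPrimes_disjoint_of_le h0j h0i hs n).symm

/-- **`0 < kMT n`, `kMT n · P_n ∈ ℤ`, `kMT n · Q(a·n) ∈ ℤ`** for `n ≥ NT ≥ 1` under a sound checker (`RayKernel.atlas_ints`; certificates:
`cert_bH1` on the big-prime windows, the checker's soundness on the table windows). -/
theorem kMT_ints {ok : WinEntry → Bool} {NT : ℕ} (hs : SoundChecker ok NT) (hNT : 1 ≤ NT)
    (hok : tab.all ok = true) (hchain : chainOK tab = true) {n : ℕ} (hn : NT ≤ n) :
    0 < kMT tab n ∧ (∃ z : ℤ, kMT tab n * h1P n = z) ∧ (∃ z : ℤ, kMT tab n * (h1Q n : ℚ) = z) := by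
  classical
  have hn1 : 1 ≤ n := le_trans hNT hn
  have h := atlas_ints (Finset.univ : Finset (Fin 4 ⊕ Fin tab.length)) (cAT tab) (cBT tab) (cwT tab) n (sharpAdmissible_bH1 hn1)
    (sharpAdmissible_bH1' hn1) (bn0_bH1' n) (rhoOf_aH1_ne_zero n) (fun i _ p hp => ?_) (combined_disjointT hs hok hchain n)
  · obtain ⟨h0, hP, hQ⟩ := h
    refine ⟨h0, ?_, ?_⟩
    · unfold kMT kM0 corrT h1P; exact hP
    · unfold kMT kM0 corrT; rw [h1Q_eq_wedge hn1]; exact hQ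
  · rcases i with i | i
    · simp only [cAT, cBT, cwT, Sum.elim_inl] at hp ⊢
      obtain ⟨hpr, hlo, hhi, hk⟩ := windowK_prime hp
      exact cert_bH1 hn1 hpr hlo hhi hk
    · simp only [cAT, cBT, cwT, Sum.elim_inr] at hp ⊢
      exact (hs _ (getElem_all hok i i.isLt)).2 n hn p hp

/-- **Size of the table multiplier**: for every `ε > 0`, eventually `kMT n ≤ e^{(141.7159 − R + ε)·n}` (`R` the table's rate). -/
theorem eventually_kMT_le_exp {ok : WinEntry → Bool} {NT : ℕ} (hs : SoundChecker ok NT) (hok : tab.all ok = true) {R : ℚ}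
    (hrate : (tab.map fun e => (e.2.2.1 : ℚ) * (e.2.1 - e.1)).sum = R) {ε : ℝ} (hε : 0 < ε) :
    ∀ᶠ n : ℕ in atTop, ((kMT tab n : ℚ) : ℝ) ≤ Real.exp ((((1417159 / 10000 - R : ℚ) : ℝ) + ε) * n) := by
  have hε2 : 0 < ε / 2 := by positivity
  have hΦ := eventually_exp_le_multiWindowProd (s := (Finset.univ : Finset (Fin 4 ⊕ Fin tab.length))) (w := cwT tab) (cAT_le_cBT hs hok) hε2
  filter_upwards [eventually_kM0_le_exp hε2, hΦ] with n hM0 hcorr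
  rw [combined_rateT hrate] at hcorr
  have hcorr' : Real.exp ((178 + ((R : ℚ) : ℝ) - ε / 2) * n) ≤ ((corrT tab n : ℕ) : ℝ) := hcorr
  have hcpos : (0 : ℝ) < ((corrT tab n : ℕ) : ℝ) := by exact_mod_cast multiWindowProd_pos _ _ _ _ _
  have hcast : ((kMT tab n : ℚ) : ℝ) = ((kM0 n : ℚ) : ℝ) / ((corrT tab n : ℕ) : ℝ) := by
    unfold kMT; push_cast; rfl
  rw [hcast]
  have hq : (((1417159 / 10000 - R : ℚ) : ℝ)) = 3197159 / 10000 - 178 - ((R : ℚ) : ℝ) := by push_cast; ring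
  calc ((kM0 n : ℚ) : ℝ) / ((corrT tab n : ℕ) : ℝ) ≤ Real.exp ((3197159 / 10000 + ε / 2) * n) / ((corrT tab n : ℕ) : ℝ) :=
        div_le_div_of_nonneg_right hM0 hcpos.le
    _ ≤ Real.exp ((3197159 / 10000 + ε / 2) * n) / Real.exp ((178 + ((R : ℚ) : ℝ) - ε / 2) * n) :=
        div_le_div_of_nonneg_left (Real.exp_pos _).le (Real.exp_pos _) hcorr'
    _ = Real.exp ((((1417159 / 10000 - R : ℚ) : ℝ) + ε) * n) := by rw [← Real.exp_sub, hq]; ring_nf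

/-- **THE EXPONENT OF ANY CHECKED TABLE** (hypothesis-free once the checker's soundness is supplied — for `entryOK cw NT`:
`soundChecker_entryOK` from the landed window theorems `∀ c ∈ cw, c.Holds`).  If `tab.all ok` for a sound checker, `chainOK tab`,
the table's rate is `R`, and `γ ≥ 0` satisfies
`γ·((141.7159 − R + 0.01) + 364673 / 5000) < 729343 / 10000 − (-273999 / 10000)`, then eventually `|ζ(5) − P_n/Q(a·n)| < 1/q_n^γ` with the INTEGERS
`p_n = kMT n·P_n`, `q_n = kMT n·|Q(a·n)| ≥ 1` (`h1_exponent_rat`).  No irrationality content (`γ < 1` in every use). -/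
theorem h1_exponent_of_table {ok : WinEntry → Bool} {NT : ℕ} (hs : SoundChecker ok NT) (hNT : 1 ≤ NT)
    (hok : tab.all ok = true) (hchain : chainOK tab = true) {R : ℚ}
    (hrate : (tab.map fun e => (e.2.2.1 : ℚ) * (e.2.1 - e.1)).sum = R) {γ : ℝ} (hγ0 : 0 ≤ γ)
    (hγ : γ * ((((1417159 / 10000 - R + 1 / 100 : ℚ)) : ℝ) + 364673 / 5000) < 729343 / 10000 - (-273999 / 10000)) :
    ∀ᶠ n : ℕ in atTop, ∃ p : ℤ, ∃ q : ℕ, 1 ≤ q ∧ (q : ℚ) = kMT tab n * |(h1Q n : ℚ)| ∧ (p : ℚ) = kMT tab n * h1P n ∧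
      |zetaValue 5 - (h1P n : ℝ) / (h1Q n : ℝ)| < 1 / (q : ℝ) ^ γ := by
  have hq : ((((1417159 / 10000 - R + 1 / 100 : ℚ)) : ℝ)) = (((1417159 / 10000 - R : ℚ)) : ℝ) + 1 / 100 := by push_cast; ring
  rw [hq] at hγ
  refine h1_exponent_rat (lam := (((1417159 / 10000 - R : ℚ)) : ℝ) + 1 / 100) (kMT tab) (fun ε hε => ?_) hγ0 hγ
  filter_upwards [eventually_kMT_le_exp hs hok hrate hε, eventually_ge_atTop NT] with n hn hnN
  obtain ⟨h0, hP, hQ⟩ := kMT_ints hs hNT hok hchain hnN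
  refine ⟨h0, hP, hQ, hn.trans ?_⟩
  apply Real.exp_le_exp.2; nlinarith [hε, (Nat.cast_nonneg n : (0:ℝ) ≤ n)]

end Summit.KontsevichZagierPeriods.Zeta5Search.RayH1
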